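import Summits.AtomisticToContinuum.Crystallization.Theses.PhononSlackCertificates
import Summits.AtomisticToContinuum.Crystallization.Theorems.ChargedEnergyGap.Negative.BlocksBound
import Summits.AtomisticToContinuum.Crystallization.Theorems.NearFieldConvexity.Negative.Comb

/-!
# Negative knowledge for crux `NearFieldConvexity` (stmt-AtomisticToContinuum-13958) — which
# hypotheses and constants of the near-field inequality are LOAD-BEARING (standing disprover, gen 1)

`PhononSlackCertificates.NearFieldConvexity` (route `PhononSlackCertificates`, rank 3): for every
`δ > 0` and `η > 0` there are `c > 0` and `C` such that for every `δ`-separated configuration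
`x : Fin N → ℝ³` and every set `Ω` of `1/20`-good particles
`c · #{i ∈ Ω : B(xᵢ,2) not η-layered} − C · #{i ∈ Ω : ∃ j ∉ Ω, |xⱼ − xᵢ| ≤ 4} ≤ Σ_{i ∈ Ω} (e_i − e*)`,
`e_i = ½ Σ_{j ≠ i} V_LJ(|xᵢ − xⱼ|)`, `e* = ⨅_Q e_LJ(Q)` (read-back `nearFieldConvexity_iff_radius`,
`Iff.rfl` against the vocabulary below).

All four facts use the collinear comb of `Negative/Comb.lean` with `Ω = {centre}`: the right-hand
side is `≤ −M/4000 + 2³²/12` (`siteEnergy_centre_le`, `neg_le_eStar`) while the left-hand side is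
`≥ −|C|` (`comb_violates`).

* `nearFieldConvexity_false_without_separation` — the `δ`-SEPARATION hypothesis cannot be dropped.
* `not_nearFieldConvexityUniform` — the constants cannot be chosen BEFORE `δ` (even depending on
  `η`): the comb is `1/(2M)`-separated; any proof has `C(δ) → ∞` as `δ → 0` (comb: `C(δ) ≥
  1/(8000δ) − 2³²/12`; the true order of the far pull is `δ⁻³`).
* `nearFieldConvexity_false_without_boundaryCharge` — the BOUNDARY CHARGE cannot be dropped
  (`C = 0`): one good particle facing dense `δ`-separated matter beyond its `3a/2`-shell has site
  energy `< e*`.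
* `not_nearFieldConvexityRadius_of_lt_one` — the boundary COLLAR RADIUS (`4` in the crux) cannot be
  taken `< 1`: below the contact distance the collar of a lone good particle is empty.
* `boundaryFloor_of_nearFieldConvexity` — the crux implies its `c = 0` shadow `BoundaryFloor`
  (the far-field content, isolated as a first target for provers and refuters alike).

Not touched here (see the workfile `Cruxes/NearFieldConvexity/Disproof.lean`): at FIXED `δ` the far
pull on the radius-`4` interior of a good `Ω` is `≤ K(δ)·#∂₄Ω`, so a kill of the crux itself needs a
`1/20`-good, non-`η`-layered bulk phase of energy density `e*` (a degenerate Lennard-Jones ground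
state, or an elastic/phonon instability of a relaxed Barlow stacking); none is known.
Supports item stmt-AtomisticToContinuum-13958.
-/

noncomputable section

open scoped BigOperators
open Literature.MathematicalPhysics.StatisticalMechanics Literature.Geometry.DiscreteGeometry

namespace Summit.AtomisticToContinuum.Crystallization.Theorems.NearFieldConvexity.Negative.LoadBearing

open Summit.AtomisticToContinuum.Crystallization.Theses.PhononSlackCertificates (NearFieldConvexity)
open Summit.AtomisticToContinuum.Crystallization.Theorems.ChargedEnergyGapNegative (eStar)
open Summit.AtomisticToContinuum.Crystallization.Theorems.NearFieldConvexity.Negative.Comb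

local notation "E3" => EuclideanSpace ℝ (Fin 3)

/-! ## Read-back vocabulary (definitionally the crux's inline texts) -/

/-- The crux's local predicate (verbatim): the radius-`2` ball of particle `i` is two-way
`η`-matched, after a translation `t`, to a rigid image of a layered set (triangular layers of spacing
`a ∈ [47/50, 1]` in hole registry along a Hägg word, interlayer spacings in `[39a/50, 17a/20]`). -/
def IsLayeredNear {N : ℕ} (η : ℝ) (x : Fin N → E3) (i : Fin N) : Prop :=
  ∃ (A : EuclideanSpace ℝ (Fin 3) →ₗᵢ[ℝ] EuclideanSpace ℝ (Fin 3)) (t : EuclideanSpace ℝ (Fin 3)) (a : ℝ)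
    (s : ℤ → ℤ) (z : ℤ → ℝ), 47 / 50 ≤ a ∧ a ≤ 1 ∧ IsHaggSeq s ∧
    (∀ m : ℤ, 39 / 50 * a ≤ z (m + 1) - z m ∧ z (m + 1) - z m ≤ 17 / 20 * a) ∧
    let S : Set (EuclideanSpace ℝ (Fin 3)) := {p | ∃ m i j : ℤ, p = A (((i : ℝ) • triangularVec₁ a) +
      ((j : ℝ) • triangularVec₂ a) + ((haggLabel s m : ℝ) • barlowOffset a) + (z m • layerNormal 1))};
    (∀ j : Fin N, dist (x j) (x i) ≤ 2 → ∃ p ∈ S, dist (x j + t) p ≤ η) ∧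
      (∀ p ∈ S, dist p (x i + t) ≤ 2 → ∃ j : Fin N, dist (x j + t) p ≤ η)

/-- `#NL_η(Ω)`: the number of particles of `Ω` whose `2`-ball is NOT `η`-layered (verbatim). -/
def nlCount {N : ℕ} (η : ℝ) (x : Fin N → E3) (Ω : Finset (Fin N)) : ℕ :=
  Nat.card {i : Fin N // i ∈ Ω ∧ ¬ IsLayeredNear η x i}

/-- `#∂_r Ω`: the number of particles of `Ω` with a particle outside `Ω` within distance `r`
(the crux has `r = 4`). -/
def bdCount {N : ℕ} (r : ℝ) (x : Fin N → E3) (Ω : Finset (Fin N)) : ℕ :=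
  Nat.card {i : Fin N // i ∈ Ω ∧ ∃ j : Fin N, j ∉ Ω ∧ dist (x j) (x i) ≤ r}

/-- `Σ_{i ∈ Ω} (e_i − e*)` with `e_i = ½ · siteEnergy` (verbatim the crux's right-hand side). -/
def excessSum {N : ℕ} (x : Fin N → E3) (Ω : Finset (Fin N)) : ℝ :=
  ∑ i ∈ Ω, ((1 / 2 : ℝ) * siteEnergy lennardJones x i - eStar)

/-- The crux with the boundary collar radius `4` replaced by a parameter `r`. -/
def NearFieldConvexityRadius (r : ℝ) : Prop :=
  ∀ δ : ℝ, 0 < δ → ∀ η : ℝ, 0 < η → ∃ c : ℝ, 0 < c ∧ ∃ C : ℝ, ∀ (N : ℕ) (x : Fin N → E3),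
    Separated δ x → ∀ Ω : Finset (Fin N), (∀ i ∈ Ω, IsTwoShellGood (1 / 20) (47 / 50) 1 x i) →
      c * (nlCount η x Ω : ℝ) - C * (bdCount r x Ω : ℝ) ≤ excessSum x Ω

/-- READ-BACK: the crux is, definitionally, `NearFieldConvexityRadius 4`. [folklore] -/
theorem nearFieldConvexity_iff_radius : NearFieldConvexity ↔ NearFieldConvexityRadius 4 := Iff.rfl

/-- The crux with the SEPARATION hypothesis dropped (so `c, C` must serve every configuration). -/
def NearFieldConvexityWithoutSeparation : Prop :=
  ∀ δ : ℝ, 0 < δ → ∀ η : ℝ, 0 < η → ∃ c : ℝ, 0 < c ∧ ∃ C : ℝ, ∀ (N : ℕ) (x : Fin N → E3),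
    ∀ Ω : Finset (Fin N), (∀ i ∈ Ω, IsTwoShellGood (1 / 20) (47 / 50) 1 x i) →
      c * (nlCount η x Ω : ℝ) - C * (bdCount 4 x Ω : ℝ) ≤ excessSum x Ω

/-- The crux with the constants chosen BEFORE `δ` (uniform in the separation; they may still depend
on `η`). -/
def NearFieldConvexityUniform : Prop :=
  ∀ η : ℝ, 0 < η → ∃ c : ℝ, 0 < c ∧ ∃ C : ℝ, ∀ δ : ℝ, 0 < δ → ∀ (N : ℕ) (x : Fin N → E3),
    Separated δ x → ∀ Ω : Finset (Fin N), (∀ i ∈ Ω, IsTwoShellGood (1 / 20) (47 / 50) 1 x i) →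
      c * (nlCount η x Ω : ℝ) - C * (bdCount 4 x Ω : ℝ) ≤ excessSum x Ω

/-- The crux WITHOUT THE BOUNDARY CHARGE (`C = 0`). -/
def NearFieldConvexityWithoutBoundaryCharge : Prop :=
  ∀ δ : ℝ, 0 < δ → ∀ η : ℝ, 0 < η → ∃ c : ℝ, 0 < c ∧ ∀ (N : ℕ) (x : Fin N → E3),
    Separated δ x → ∀ Ω : Finset (Fin N), (∀ i ∈ Ω, IsTwoShellGood (1 / 20) (47 / 50) 1 x i) →
      c * (nlCount η x Ω : ℝ) ≤ excessSum x Ω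

/-! ## Scalar facts -/

/-- `e* ≥ −2³²/12` (finite stability through blocks, `ChargedEnergyGapNegative.Blocks`). [folklore] -/
theorem neg_le_eStar : -(65536 ^ 2 / 12 : ℝ) ≤ eStar :=
  le_ciInf fun Q =>
    Summit.AtomisticToContinuum.Crystallization.Theorems.ChargedEnergyGapNegative.Blocks.neg_le_energyPerParticle Q

/-! ## The violation -/

/-- `Ω = {i₀}` has at most one boundary particle. -/
theorem bdCount_singleton_le_one {N : ℕ} (r : ℝ) (x : Fin N → E3) (i₀ : Fin N) :
    bdCount r x {i₀} ≤ 1 := by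
  unfold bdCount
  refine Finite.card_le_one_iff_subsingleton.2 ⟨fun a b => Subtype.ext ?_⟩
  exact (Finset.mem_singleton.1 a.2.1).trans (Finset.mem_singleton.1 b.2.1).symm

/-- For the comb and a collar radius `r < 1`, `Ω = {centre}` has NO boundary particle. -/
theorem bdCount_centre_eq_zero (M : ℕ) {r : ℝ} (hr : r < 1) : bdCount r (comb M) {centre M} = 0 := by
  unfold bdCount
  rw [Nat.card_eq_zero]
  left
  refine ⟨fun ⟨i, hi, j, hj, hd⟩ => ?_⟩
  rw [Finset.mem_singleton] at hi hj
  subst hi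
  obtain ⟨u, rfl⟩ := (combIdx M).symm.surjective j
  have hu : u ≠ Sum.inr 0 := fun h => hj (by rw [h]; rfl)
  rw [comb_symm_apply, comb_centre, dist_zero_right] at hd
  have := one_le_norm_combPos M hu
  linarith

/-- `Σ_{i ∈ {i₀}} (e_i − e*) = e_{i₀} − e*`. [folklore] -/
theorem excessSum_singleton {N : ℕ} (x : Fin N → E3) (i₀ : Fin N) :
    excessSum x {i₀} = 1 / 2 * siteEnergy lennardJones x i₀ - eStar :=
  Finset.sum_singleton _ _

/-- **The comb violates the near-field inequality at `Ω = {centre}`** for every `c > 0`, every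
`C` with `4000·(2³²/12 + |C| + 1) ≤ M`, every collar radius and every `η`. [folklore] -/
theorem comb_violates {c C r η : ℝ} (hc : 0 < c) {M : ℕ}
    (hbig : 4000 * (65536 ^ 2 / 12 + |C| + 1) ≤ (M : ℝ)) :
    ¬ (c * (nlCount η (comb M) {centre M} : ℝ) - C * (bdCount r (comb M) {centre M} : ℝ) ≤
        excessSum (comb M) {centre M}) := by
  intro h
  rw [excessSum_singleton] at h
  have h1 : 0 ≤ c * (nlCount η (comb M) {centre M} : ℝ) := mul_nonneg hc.le (Nat.cast_nonneg _)
  have hb : (bdCount r (comb M) {centre M} : ℝ) ≤ 1 := by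
    exact_mod_cast bdCount_singleton_le_one r (comb M) (centre M)
  have hb0 : (0 : ℝ) ≤ (bdCount r (comb M) {centre M} : ℝ) := Nat.cast_nonneg _
  have h2 : C * (bdCount r (comb M) {centre M} : ℝ) ≤ |C| :=
    calc C * (bdCount r (comb M) {centre M} : ℝ) ≤ |C| * (bdCount r (comb M) {centre M} : ℝ) :=
          mul_le_mul_of_nonneg_right (le_abs_self C) hb0
      _ ≤ |C| * 1 := mul_le_mul_of_nonneg_left hb (abs_nonneg C)
      _ = |C| := mul_one _
  have h3 := siteEnergy_centre_le M
  have h4 := neg_le_eStar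
  linarith

/-- A large enough `M`. -/
theorem exists_big (C : ℝ) : ∃ M : ℕ, 1 ≤ M ∧ 4000 * (65536 ^ 2 / 12 + |C| + 1) ≤ (M : ℝ) := by
  obtain ⟨M, hM⟩ := exists_nat_ge (4000 * (65536 ^ 2 / 12 + |C| + 1))
  refine ⟨M, ?_, hM⟩
  have h0 : (1 : ℝ) ≤ 4000 * (65536 ^ 2 / 12 + |C| + 1) := by nlinarith [abs_nonneg C]
  exact_mod_cast h0.trans hM

/-- `Ω = {centre}` consists of good particles. [folklore] -/
theorem good_of_mem_centre (M : ℕ) :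
    ∀ i ∈ ({centre M} : Finset (Fin (M + 18 + 1))), IsTwoShellGood (1 / 20) (47 / 50) 1 (comb M) i := by
  intro i hi
  rw [Finset.mem_singleton] at hi
  rw [hi]
  exact good_centre M

/-- `0 < 1/(2M)`. [folklore] -/
theorem sep_pos {M : ℕ} (hM : 1 ≤ M) : (0 : ℝ) < 1 / (2 * (M : ℝ)) := by
  have : (0 : ℝ) < M := by exact_mod_cast hM
  positivity

/-! ## The four negative facts -/

/-- **Separation is load-bearing**: with the `δ`-separation hypothesis dropped, `NearFieldConvexity`
is FALSE (the comb with `M → ∞`: a lone good particle next to arbitrarily dense far matter has site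
energy `→ −∞`, while `Ω = {centre}` has one boundary particle). [folklore] -/
theorem nearFieldConvexity_false_without_separation : ¬ NearFieldConvexityWithoutSeparation := by
  intro h
  obtain ⟨c, hc, C, h⟩ := h 1 one_pos 1 one_pos
  obtain ⟨M, hM, hbig⟩ := exists_big C
  exact comb_violates hc hbig (h _ (comb M) {centre M} (good_of_mem_centre M))

/-- **The constants cannot be uniform in `δ`**: `∃ c, C ∀ δ` (after `η`) is FALSE — the comb is
`1/(2M)`-separated and beats every fixed `C` as `M → ∞`; any proof has `C(δ) → ∞` as `δ → 0`.
[folklore] -/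
theorem not_nearFieldConvexityUniform : ¬ NearFieldConvexityUniform := by
  intro h
  obtain ⟨c, hc, C, h⟩ := h 1 one_pos
  obtain ⟨M, hM, hbig⟩ := exists_big C
  exact comb_violates hc hbig
    (h _ (sep_pos hM) _ (comb M) (comb_separated hM) {centre M} (good_of_mem_centre M))

/-- **The boundary charge is load-bearing**: with `C = 0` the statement is FALSE at
`δ = 1/(2M)`, `M = ⌈4000·(2³²/12 + 1)⌉`: the good centre of the comb has `e_centre < e*`. [folklore] -/
theorem nearFieldConvexity_false_without_boundaryCharge : ¬ NearFieldConvexityWithoutBoundaryCharge := by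
  intro h
  obtain ⟨M, hM, hbig⟩ := exists_big 0
  obtain ⟨c, hc, h⟩ := h _ (sep_pos hM) 1 one_pos
  have key := h _ (comb M) (comb_separated hM) {centre M} (good_of_mem_centre M)
  refine comb_violates (C := 0) (r := 4) (η := 1) hc hbig ?_
  rw [zero_mul, sub_zero]
  exact key

/-- **The boundary collar must reach the contact distance**: for every radius `r < 1` the crux with
`#∂_r Ω` in place of `#∂₄ Ω` is FALSE (the collar of the lone good centre is then empty, so the
boundary charge is void and the previous witness applies). [folklore] -/
theorem not_nearFieldConvexityRadius_of_lt_one {r : ℝ} (hr : r < 1) : ¬ NearFieldConvexityRadius r := by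
  intro h
  obtain ⟨M, hM, hbig⟩ := exists_big 0
  obtain ⟨c, hc, C, h⟩ := h _ (sep_pos hM) 1 one_pos
  have key := h _ (comb M) (comb_separated hM) {centre M} (good_of_mem_centre M)
  rw [bdCount_centre_eq_zero M hr, Nat.cast_zero, mul_zero, sub_zero] at key
  refine comb_violates (C := 0) (r := r) (η := 1) hc hbig ?_
  rw [zero_mul, sub_zero]
  exact key


/-! ## The far-field shadow of the crux -/

/-- The BOUNDARY FLOOR: `Σ_{i∈Ω}(e_i − e*) ≥ −C(δ)·#∂₄Ω` for every `δ`-separated `x` and every good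
`Ω` — the `c = 0` shadow of the crux.  Its content is purely far-field (periodisation floor
`E(x|_Ω) ≥ |Ω|·e*` plus boundary-summability of the `r⁻⁶` pull of the matter outside `Ω` on the
radius-`4` interior); by the comb it, too, needs `C = C(δ) → ∞` as `δ → 0`. -/
def BoundaryFloor : Prop :=
  ∀ δ : ℝ, 0 < δ → ∃ C : ℝ, ∀ (N : ℕ) (x : Fin N → E3), Separated δ x →
    ∀ Ω : Finset (Fin N), (∀ i ∈ Ω, IsTwoShellGood (1 / 20) (47 / 50) 1 x i) →
      -(C * (bdCount 4 x Ω : ℝ)) ≤ excessSum x Ω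

/-- **The crux implies the boundary floor** (drop the non-negative `c`-term at `η = 1`): a prover
can land this far-field statement first; a refuter who breaks it breaks the crux. [folklore] -/
theorem boundaryFloor_of_nearFieldConvexity (h : NearFieldConvexity) : BoundaryFloor := by
  intro δ hδ
  obtain ⟨c, hc, C, h⟩ := (nearFieldConvexity_iff_radius.1 h) δ hδ 1 one_pos
  refine ⟨C, fun N x hsep Ω hΩ => ?_⟩
  have key := h N x hsep Ω hΩ
  have h1 : 0 ≤ c * (nlCount 1 x Ω : ℝ) := mul_nonneg hc.le (Nat.cast_nonneg _)
  linarith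

end Summit.AtomisticToContinuum.Crystallization.Theorems.NearFieldConvexity.Negative.LoadBearing
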